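import Literature.Algebra.EuclideanLattices.SmoothingGaussianFourier
import Literature.Algebra.EuclideanLattices.LatticeGeometryMinkowskiSecondHermite
import HarnessLib

/-!
# Regev 2009, Lemma 3.15: a discrete Gaussian above `√2 η_ε` escapes every hyperplane

Topic `Algebra/EuclideanLattices` (family `pqc`). This file serves the decomposition of the named
fact `Literature.Computability.Cryptography.regev_lwe_to_sivp_quantum` (pqc.S19; Regev, J. ACM 56
(2009), Thm 1.1), more precisely of its last step, the reduction `GIVP_{2√n φ} ≤ DGS_φ`
(Lemma 3.17, hypothesis `h₃` of
`Literature.Computability.Cryptography.regev_lwe_to_sivp_quantum_of_worstCase`), whose probabilistic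
core is Corollary 3.16 ("`n²` independent samples from `D_{L,r}` contain `n` linearly independent
vectors"), itself proved from

**Lemma 3.15** (Regev 2009, p. 21; = the preliminary version of Micciancio–Regev 2004, Lemma 4.3).
*Let `L` be an `n`-dimensional lattice and let `r ≥ √2 η_ε(L)` where `ε ≤ 1/10`. Then for any
subspace `H` of dimension at most `n - 1` the probability that `x ∉ H`, where `x` is chosen from
`D_{L,r}`, is at least `1/10`.*

Everything here is PROVED; theorems only, no named facts. The printed proof is followed literally:
for a unit vector `u ⊥ H`,
`Pr[x ∈ H] ≤ E_{x ∼ D_{L,r}}[exp(-π (⟨x,u⟩/r)²)]`, and the numerator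
`∑_{x ∈ L} exp(-π (‖x‖² + ⟨x,u⟩²)/r²) = ρ_r(T L)` is the Gaussian mass of the *sheared lattice*
`T L`, `T = id + (√2 - 1) ⟨u, ·⟩ u` (the linear map `diag(√2, 1, …, 1)` in coordinates with first
axis `u`, which is how the printed proof writes it: "assume without loss of generality that
`(1, 0, …, 0)` is orthogonal to `H`"). By the Poisson summation formula
(`tsum_gaussianFunction_eq`, Banaszczyk 1993 Lemma 1.1) `ρ_r(TL) = vol(TL)⁻¹ rⁿ ρ_{1/r}((TL)*)` with
`vol(TL) = √2 · vol(L)` (`covolume_comap_symm_eq_abs_det_mul_covolume`, `det T = √2`) and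
`(TL)* = T⁻¹(L*)`, `ρ_{1/r}(T⁻¹ y) ≤ ρ_{√2/r}(y)`, so `ρ_{1/r}((TL)*) ≤ ρ_{√2/r}(L*) ≤ 1 + ε` for
`r/√2 ≥ η_ε(L)`; and `ρ_r(L) = vol(L)⁻¹ rⁿ ρ_{1/r}(L*) ≥ vol(L)⁻¹ rⁿ`. Hence
`Pr[x ∈ H] ≤ (1 + ε)/√2` (`toOuterMeasure_discreteGaussian_mem_submodule_le`), which is `< 9/10`
for `ε ≤ 1/10` (`lemma_3_15`). Probabilities are `PMF.toOuterMeasure` masses (no measurable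
structure on `V` is needed in the statements; the proofs `borelize`).

## Main results

* `Regev2009.shear`, `Regev2009.norm_shear_sq`, `Regev2009.det_shear` — the shear `T` and
  `‖T x‖² = ‖x‖² + ⟨u, x⟩²`, `det T = √2`.
* `Regev2009.tsum_gaussianFunction_mul_le` — `∑_{x ∈ L} ρ_r(x) e^{-π⟨u,x⟩²/r²} ≤ (1+ε)/√2 · ρ_r(L)`.
* `Regev2009.toOuterMeasure_discreteGaussian_mem_submodule_le` — `Pr_{D_{L,r}}[x ∈ H] ≤ (1 + ε)/√2`
  for `H ≠ ⊤`, `0 < ε`, `0 < r`, `√2 η_ε(L) ≤ r`.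
* `Regev2009.lemma_3_15` — the printed statement: `1/10 ≤ Pr_{D_{L,r}}[x ∉ H]` for `ε ≤ 1/10`.

## References

* O. Regev, *On lattices, learning with errors, random linear codes, and cryptography*, J. ACM 56
  (2009), art. 34 (author's version arXiv:2401.03703), Lemma 3.15, p. 21 [Regev2009].
* D. Micciancio, O. Regev, *Worst-case to average-case reductions based on Gaussian measures*,
  FOCS 2004 (preliminary version), Lemma 4.3; SIAM J. Comput. 37 (2007), Def. 3.1
  [MicciancioRegev2007].
* W. Banaszczyk, *New bounds in some transference theorems in the geometry of numbers*,
  Math. Ann. 296 (1993), Lemma 1.1 [Banaszczyk1993].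
* J. W. S. Cassels, *An Introduction to the Geometry of Numbers*, Springer 1997, Ch. I §3
  (lattices under linear transformation) [Cassels1997].
-/

noncomputable section

open MeasureTheory Module
open scoped Real ENNReal InnerProductSpace

namespace Literature.Algebra.EuclideanLattices

namespace Regev2009

variable {V : Type*} [NormedAddCommGroup V] [InnerProductSpace ℝ V]

/-! ### The shear `x ↦ x + c ⟨u, x⟩ u` -/

/-- The rank-one shear `x ↦ x + c ⟨u, x⟩ u` along `u`, as a continuous linear map (for a unit
vector `u` and `c = √2 - 1` this is `diag(√2, 1, …, 1)` in an orthonormal frame with first vector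
`u`, the change of variables of the proof of Regev 2009, Lemma 3.15). [cite: Regev2009, Lemma 3.15 (proof)] -/
def shearCLM (c : ℝ) (u : V) : V →L[ℝ] V :=
  ContinuousLinearMap.id ℝ V + c • (innerSL ℝ u).smulRight u

/-- Value of the shear. [folklore] -/
@[simp] theorem shearCLM_apply (c : ℝ) (u x : V) :
    shearCLM c u x = x + c • (⟪u, x⟫_ℝ • u) := by
  simp [shearCLM]

/-- Composition of two shears along the same unit vector:
`T_c (T_{c'} x) = x + (c + c' + c c') ⟨u, x⟩ u`. [folklore] -/
theorem shearCLM_shearCLM {u : V} (hu : ‖u‖ = 1) (c c' : ℝ) (x : V) :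
    shearCLM c u (shearCLM c' u x) = x + (c + c' + c * c') • (⟪u, x⟫_ℝ • u) := by
  simp only [shearCLM_apply, inner_add_right, inner_smul_right, real_inner_self_eq_norm_sq, hu,
    one_pow, mul_one]
  module

/-- The shear is self-adjoint: `⟨T_c x, y⟩ = ⟨x, T_c y⟩`. [folklore] -/
theorem inner_shearCLM_left (c : ℝ) (u x y : V) :
    ⟪shearCLM c u x, y⟫_ℝ = ⟪x, shearCLM c u y⟫_ℝ := by
  simp only [shearCLM_apply, inner_add_left, inner_add_right, inner_smul_left, inner_smul_right,
    RCLike.conj_to_real]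
  rw [real_inner_comm x u]
  ring

/-- `‖T_c x‖² = ‖x‖² + (2c + c²) ⟨u, x⟩²` for a unit vector `u`. [folklore] -/
theorem norm_shearCLM_sq {u : V} (hu : ‖u‖ = 1) (c : ℝ) (x : V) :
    ‖shearCLM c u x‖ ^ 2 = ‖x‖ ^ 2 + (2 * c + c ^ 2) * ⟪u, x⟫_ℝ ^ 2 := by
  rw [shearCLM_apply, norm_add_sq_real, inner_smul_right, inner_smul_right, real_inner_comm u x,
    norm_smul, norm_smul, hu, mul_one, Real.norm_eq_abs, Real.norm_eq_abs, mul_pow, sq_abs, sq_abs]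
  ring

/-- `√2 - 1 + ((√2)⁻¹ - 1) + (√2 - 1)((√2)⁻¹ - 1) = 0`: the two shears used below are inverse
to each other. [folklore] -/
theorem shear_consts_eq_zero :
    (Real.sqrt 2 - 1) + ((Real.sqrt 2)⁻¹ - 1) + (Real.sqrt 2 - 1) * ((Real.sqrt 2)⁻¹ - 1) = 0 := by
  have h : Real.sqrt 2 ≠ 0 := by positivity
  field_simp
  ring

/-- **The change of variables of Regev's Lemma 3.15**: the shear `T = id + (√2 - 1)⟨u, ·⟩u` along
a unit vector `u`, with inverse `id + ((√2)⁻¹ - 1)⟨u, ·⟩u`, as a continuous linear automorphism.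
[cite: Regev2009, Lemma 3.15 (proof)] -/
def shear {u : V} (hu : ‖u‖ = 1) : V ≃L[ℝ] V :=
  ContinuousLinearEquiv.equivOfInverse (shearCLM (Real.sqrt 2 - 1) u)
    (shearCLM ((Real.sqrt 2)⁻¹ - 1) u)
    (fun x => by
      rw [shearCLM_shearCLM hu, show (Real.sqrt 2)⁻¹ - 1 + (Real.sqrt 2 - 1) +
        ((Real.sqrt 2)⁻¹ - 1) * (Real.sqrt 2 - 1) = 0 by linear_combination shear_consts_eq_zero,
        zero_smul, add_zero])
    (fun x => by rw [shearCLM_shearCLM hu, shear_consts_eq_zero, zero_smul, add_zero])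

/-- Value of the shear `T`. [folklore] -/
theorem shear_apply {u : V} (hu : ‖u‖ = 1) (x : V) :
    shear hu x = x + (Real.sqrt 2 - 1) • (⟪u, x⟫_ℝ • u) := by
  simp [shear]

/-- Value of `T⁻¹`. [folklore] -/
theorem shear_symm_apply {u : V} (hu : ‖u‖ = 1) (x : V) :
    (shear hu).symm x = x + ((Real.sqrt 2)⁻¹ - 1) • (⟪u, x⟫_ℝ • u) := by
  simp [shear]

/-- `T` is self-adjoint. [folklore] -/
theorem inner_shear_left {u : V} (hu : ‖u‖ = 1) (x y : V) :
    ⟪shear hu x, y⟫_ℝ = ⟪x, shear hu y⟫_ℝ := by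
  rw [shear_apply, shear_apply, ← shearCLM_apply, ← shearCLM_apply, inner_shearCLM_left]

/-- **`‖T x‖² = ‖x‖² + ⟨u, x⟩²`** (`(√2 x₁)² + x₂² + ⋯ + xₙ²` in the coordinates of the printed
proof). [cite: Regev2009, Lemma 3.15 (proof)] -/
theorem norm_shear_sq {u : V} (hu : ‖u‖ = 1) (x : V) :
    ‖shear hu x‖ ^ 2 = ‖x‖ ^ 2 + ⟪u, x⟫_ℝ ^ 2 := by
  rw [shear_apply, ← shearCLM_apply, norm_shearCLM_sq hu]
  have h2 : Real.sqrt 2 ^ 2 = 2 := Real.sq_sqrt zero_le_two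
  nlinarith [h2]

/-- **`‖T⁻¹ y‖² = ‖y‖² - ⟨u, y⟩²/2`** (`(y₁/√2)² + y₂² + ⋯ + yₙ²`). [cite: Regev2009, Lemma 3.15 (proof)] -/
theorem norm_shear_symm_sq {u : V} (hu : ‖u‖ = 1) (y : V) :
    ‖(shear hu).symm y‖ ^ 2 = ‖y‖ ^ 2 - ⟪u, y⟫_ℝ ^ 2 / 2 := by
  rw [shear_symm_apply, ← shearCLM_apply, norm_shearCLM_sq hu]
  have h : Real.sqrt 2 ≠ 0 := by positivity
  have h2 : Real.sqrt 2 ^ 2 = 2 := Real.sq_sqrt zero_le_two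
  field_simp
  nlinarith [h2]

/-- `‖y‖²/2 ≤ ‖T⁻¹ y‖²` (Cauchy–Schwarz `⟨u, y⟩² ≤ ‖y‖²`). [folklore] -/
theorem half_norm_sq_le_norm_shear_symm_sq {u : V} (hu : ‖u‖ = 1) (y : V) :
    ‖y‖ ^ 2 / 2 ≤ ‖(shear hu).symm y‖ ^ 2 := by
  rw [norm_shear_symm_sq hu]
  have h := abs_real_inner_le_norm u y
  rw [hu, one_mul] at h
  have h' : ⟪u, y⟫_ℝ ^ 2 ≤ ‖y‖ ^ 2 := by
    rw [← sq_abs]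
    exact pow_le_pow_left₀ (abs_nonneg _) h 2
  linarith

/-! ### `det T = √2` -/

section Det

variable [FiniteDimensional ℝ V]

/-- **`det T = √2`**: in an orthonormal basis extending `u` the shear is `diag(√2, 1, …, 1)`.
[cite: Regev2009, Lemma 3.15 (proof)] -/
theorem det_shear {u : V} (hu : ‖u‖ = 1) :
    LinearMap.det ((shear hu).toLinearEquiv : V →ₗ[ℝ] V) = Real.sqrt 2 := by
  classical
  -- an orthonormal basis `b` of `V` through `u`
  have hon : Orthonormal ℝ ((↑) : ({u} : Set V) → V) := by
    rw [orthonormal_subtype_iff_ite]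
    intro v hv w hw
    rw [Set.mem_singleton_iff] at hv hw
    subst hv; subst hw
    simp [hu]
  obtain ⟨s, b, hus, hb⟩ := hon.exists_orthonormalBasis_extension
  have hu_mem : u ∈ s := hus (Set.mem_singleton u)
  set i₀ : s := ⟨u, hu_mem⟩ with hi₀
  have hbi₀ : b i₀ = u := by rw [hb]
  -- the scaling factors
  have hsqrt : Real.sqrt 2 ≠ 0 := by positivity
  let w : s → ℝˣ := fun i => if i = i₀ then Units.mk0 (Real.sqrt 2) hsqrt else 1
  set e : Basis s ℝ V := b.toBasis with he
  -- `T (b i) = w i • b i`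
  have hT : ∀ i, shear hu (e i) = (w i : ℝ) • e i := by
    intro i
    rw [he, OrthonormalBasis.coe_toBasis, shear_apply]
    by_cases hi : i = i₀
    · subst hi
      rw [hbi₀, real_inner_self_eq_norm_sq, hu]
      simp only [w, if_true, Units.val_mk0, one_pow, one_smul]
      module
    · have h0 : ⟪u, b i⟫_ℝ = 0 := by
        rw [← hbi₀]
        have := orthonormal_iff_ite.mp b.orthonormal i₀ i
        rw [this, if_neg (Ne.symm hi)]
      simp [w, hi, h0]
  -- hence `T ∘ e = e.unitsSMul w` and `det T = ∏ w = √2`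
  have hcomp : ((shear hu).toLinearEquiv : V →ₗ[ℝ] V) ∘ ⇑e = ⇑(e.unitsSMul w) := by
    funext i
    rw [Function.comp_apply, Basis.unitsSMul_apply, Units.smul_def, ← hT i]
    rfl
  have h1 := e.det_comp ((shear hu).toLinearEquiv : V →ₗ[ℝ] V) e
  rw [e.det_self, mul_one, hcomp, e.det_unitsSMul_self] at h1
  rw [← h1, Fintype.prod_eq_single i₀ (fun i hi => by simp [w, hi])]
  simp [w]

end Det

/-! ### The Gaussian weights along the shear -/

/-- **`ρ_r(x) · e^{-π⟨u,x⟩²/r²} = ρ_r(T x)`** (the first display of the printed proof, read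
backwards). [cite: Regev2009, Lemma 3.15 (proof)] -/
theorem gaussianFunction_mul_gaussianFunction_inner {u : V} (hu : ‖u‖ = 1) (r : ℝ) (x : V) :
    gaussianFunction r x * gaussianFunction r (⟪u, x⟫_ℝ) = gaussianFunction r (shear hu x) := by
  simp only [gaussianFunction, ← Real.exp_add, Real.norm_eq_abs, sq_abs, norm_shear_sq hu]
  congr 1
  ring

/-- **`ρ_{1/r}(T⁻¹ y) ≤ ρ_{√2/r}(y)`**, i.e. `ρ_{(r/√2)⁻¹}(y)` (since `‖T⁻¹ y‖² ≥ ‖y‖²/2`; the step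
"`≤ ρ_{√2/r}(L*)`" of the printed proof). [cite: Regev2009, Lemma 3.15 (proof)] -/
theorem gaussianFunction_shear_symm_le {u : V} (hu : ‖u‖ = 1) {r : ℝ} (hr : 0 < r) (y : V) :
    gaussianFunction r⁻¹ ((shear hu).symm y) ≤ gaussianFunction (r / Real.sqrt 2)⁻¹ y := by
  unfold gaussianFunction
  rw [Real.exp_le_exp, inv_pow, inv_pow, div_pow, Real.sq_sqrt zero_le_two, div_inv_eq_mul,
    div_inv_eq_mul]
  have h := half_norm_sq_le_norm_shear_symm_sq hu y
  have hπr : 0 < π * r ^ 2 := by positivity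
  have h' : π * r ^ 2 * (‖y‖ ^ 2 / 2) ≤ π * r ^ 2 * ‖(shear hu).symm y‖ ^ 2 :=
    mul_le_mul_of_nonneg_left h hπr.le
  nlinarith [h']

/-! ### The sheared lattice and its dual -/

section Lattice

variable (L : Submodule ℤ V)

/-- The sheared lattice `T L`, as `ZLattice.comap` of `L` along `T⁻¹` (a full-rank lattice again,
by Mathlib's instances for `ZLattice.comap` along a continuous linear equivalence).
[cite: Cassels1997, Ch. I §3 (lattices under linear transformation)] -/
abbrev shearLattice {u : V} (hu : ‖u‖ = 1) : Submodule ℤ V :=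
  ZLattice.comap ℝ L (shear hu).symm.toLinearMap

/-- Membership in `T L`: `y ∈ T L ↔ T⁻¹ y ∈ L`. [folklore] -/
theorem mem_shearLattice_iff {u : V} (hu : ‖u‖ = 1) (y : V) :
    y ∈ shearLattice L hu ↔ (shear hu).symm y ∈ L := Iff.rfl

/-- `x ∈ L ↔ T x ∈ T L`. [folklore] -/
theorem shear_mem_shearLattice_iff {u : V} (hu : ‖u‖ = 1) (x : V) :
    shear hu x ∈ shearLattice L hu ↔ x ∈ L := by
  rw [mem_shearLattice_iff]
  simp

/-- **`(T L)* = T⁻¹ (L*)`**: `w ∈ (TL)* ↔ T w ∈ L*` (`T` is self-adjoint). [cite: Regev2009, Lemma 3.15 (proof)] -/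
theorem mem_dualLattice_shearLattice_iff {u : V} (hu : ‖u‖ = 1) (w : V) :
    w ∈ dualLattice (shearLattice L hu) ↔ shear hu w ∈ dualLattice L := by
  simp only [mem_dualLattice, mem_shearLattice_iff]
  constructor
  · intro h y hy
    obtain ⟨n, hn⟩ := h (shear hu y) (by simpa using hy)
    exact ⟨n, by rw [hn, inner_shear_left]⟩
  · intro h y hy
    obtain ⟨n, hn⟩ := h ((shear hu).symm y) hy
    refine ⟨n, ?_⟩
    rw [hn, inner_shear_left, ContinuousLinearEquiv.apply_symm_apply]

/-- **`ρ_r(T L) = ∑_{x ∈ L} ρ_r(T x)`** (reindexing along `T : L ≃ T L`). [folklore] -/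
theorem tsum_gaussianFunction_shearLattice {u : V} (hu : ‖u‖ = 1) (r : ℝ) :
    ∑' y : shearLattice L hu, gaussianFunction r (y : V) =
      ∑' x : L, gaussianFunction r (shear hu x) := by
  let e : L ≃ shearLattice L hu :=
    (shear hu).toEquiv.subtypeEquiv fun x => (shear_mem_shearLattice_iff L hu x).symm
  rw [← e.tsum_eq]
  rfl

/-- **`ρ_{1/r}((T L)*) = ∑_{y ∈ L*} ρ_{1/r}(T⁻¹ y)`** (reindexing along `T : (TL)* ≃ L*`). [folklore] -/
theorem tsum_gaussianFunction_dualLattice_shearLattice {u : V} (hu : ‖u‖ = 1) (s : ℝ) :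
    ∑' w : dualLattice (shearLattice L hu), gaussianFunction s (w : V) =
      ∑' y : dualLattice L, gaussianFunction s ((shear hu).symm y) := by
  let e : dualLattice (shearLattice L hu) ≃ dualLattice L :=
    (shear hu).toEquiv.subtypeEquiv fun w => mem_dualLattice_shearLattice_iff L hu w
  rw [← e.symm.tsum_eq]
  exact tsum_congr fun y => rfl

variable [FiniteDimensional ℝ V] [DiscreteTopology L] [IsZLattice ℝ L]

/-- **`ρ_{1/r}((TL)*) ≤ 1 + ε` for `r/√2 ≥ η_ε(L)`** (the two inequalities
"`≤ ρ_{√2/r}(L*) ≤ 1 + ε`" of the printed proof). [cite: Regev2009, Lemma 3.15 (proof)] -/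
theorem tsum_gaussianFunction_dualLattice_shearLattice_le {u : V} (hu : ‖u‖ = 1) {ε r : ℝ}
    (hε : 0 < ε) (hr : 0 < r) (hηr : smoothingParameter L ε ≤ r / Real.sqrt 2) :
    ∑' w : dualLattice (shearLattice L hu), gaussianFunction r⁻¹ (w : V) ≤ 1 + ε := by
  rw [tsum_gaussianFunction_dualLattice_shearLattice L hu]
  have hs : 0 < r / Real.sqrt 2 := by positivity
  refine le_trans ?_ (tsum_gaussianFunction_dual_le_one_add L hε hs hηr)
  refine Summable.tsum_le_tsum (fun y => gaussianFunction_shear_symm_le hu hr (y : V)) ?_ ?_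
  · refine Summable.of_nonneg_of_le (fun _ => (gaussianFunction_pos _ _).le)
      (fun y => gaussianFunction_shear_symm_le hu hr (y : V)) ?_
    exact (summable_gaussianFunction_sub (dualLattice L) (inv_ne_zero hs.ne') (0 : V)).congr
      fun w => by rw [sub_zero]
  · exact (summable_gaussianFunction_sub (dualLattice L) (inv_ne_zero hs.ne') (0 : V)).congr
      fun w => by rw [sub_zero]

/-- **The numerator bound of Lemma 3.15**:
`∑_{x ∈ L} ρ_r(x) e^{-π⟨u,x⟩²/r²} ≤ (1 + ε)/√2 · ρ_r(L)` for a unit vector `u`, `0 < ε`, `0 < r`,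
`√2 η_ε(L) ≤ r` (Poisson summation on `T L` and on `L`: `ρ_r(TL) = vol(L)⁻¹ (√2)⁻¹ rⁿ ρ_{1/r}((TL)*)
≤ vol(L)⁻¹ (√2)⁻¹ rⁿ (1 + ε)` and `ρ_r(L) = vol(L)⁻¹ rⁿ ρ_{1/r}(L*) ≥ vol(L)⁻¹ rⁿ`).
[cite: Regev2009, Lemma 3.15 (proof)] -/
theorem tsum_gaussianFunction_mul_le {u : V} (hu : ‖u‖ = 1) {ε r : ℝ} (hε : 0 < ε) (hr : 0 < r)
    (hηr : Real.sqrt 2 * smoothingParameter L ε ≤ r) :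
    ∑' x : L, gaussianFunction r (x : V) * gaussianFunction r (⟪u, (x : V)⟫_ℝ) ≤
      (1 + ε) / Real.sqrt 2 * ∑' x : L, gaussianFunction r (x : V) := by
  borelize V
  have hsqrt : 0 < Real.sqrt 2 := by positivity
  have hηr' : smoothingParameter L ε ≤ r / Real.sqrt 2 := by
    rw [le_div_iff₀ hsqrt, mul_comm]; exact hηr
  -- the numerator is `ρ_r(TL)`
  simp_rw [gaussianFunction_mul_gaussianFunction_inner hu]
  rw [← tsum_gaussianFunction_shearLattice L hu r]
  -- Poisson on `TL` and on `L`
  rw [tsum_gaussianFunction_eq (shearLattice L hu) hr, tsum_gaussianFunction_eq L hr]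
  -- covolumes
  have hcov : ZLattice.covolume (shearLattice L hu) = Real.sqrt 2 * ZLattice.covolume L := by
    rw [shearLattice, covolume_comap_symm_eq_abs_det_mul_covolume L volume (shear hu), det_shear hu,
      abs_of_pos hsqrt]
  rw [hcov]
  have hvol : 0 < ZLattice.covolume L := ZLattice.covolume_pos L volume
  have hrn : 0 < r ^ finrank ℝ V := pow_pos hr _
  -- dual sides
  have hnum := tsum_gaussianFunction_dualLattice_shearLattice_le L hu hε hr hηr'
  have hden : 1 ≤ ∑' w : dualLattice L, gaussianFunction r⁻¹ (w : V) := by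
    have hsum : Summable fun w : dualLattice L => gaussianFunction r⁻¹ (w : V) :=
      (summable_gaussianFunction_sub (dualLattice L) (inv_ne_zero hr.ne') (0 : V)).congr
        fun w => by rw [sub_zero]
    have h0 := hsum.le_tsum ⟨0, (dualLattice L).zero_mem⟩ fun w _ => (gaussianFunction_pos _ _).le
    simpa using h0
  calc (Real.sqrt 2 * ZLattice.covolume L)⁻¹ * r ^ finrank ℝ V *
        ∑' w : dualLattice (shearLattice L hu), gaussianFunction r⁻¹ (w : V)
      ≤ (Real.sqrt 2 * ZLattice.covolume L)⁻¹ * r ^ finrank ℝ V * (1 + ε) := by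
        gcongr
    _ = (1 + ε) / Real.sqrt 2 * ((ZLattice.covolume L)⁻¹ * r ^ finrank ℝ V * 1) := by
        field_simp
    _ ≤ (1 + ε) / Real.sqrt 2 *
        ((ZLattice.covolume L)⁻¹ * r ^ finrank ℝ V * ∑' w : dualLattice L, gaussianFunction r⁻¹ (w : V)) := by
        gcongr

/-! ### Lemma 3.15 -/

/-- **Regev 2009, Lemma 3.15 (quantitative form).** For a full-rank lattice `L`, `0 < ε`, `0 < r`
with `√2 η_ε(L) ≤ r`, and a proper subspace `H ≠ V`:
`Pr_{x ∼ D_{L,r}}[x ∈ H] ≤ (1 + ε)/√2` (the `D_{L,r}`-mass, `PMF.toOuterMeasure`, of the event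
`x ∈ H`). Proof as printed: for a unit vector `u ⊥ H`,
`Pr[x ∈ H] ≤ E[e^{-π⟨u,x⟩²/r²}] = (∑_{x ∈ L} ρ_r(x) e^{-π⟨u,x⟩²/r²}) / ρ_r(L) ≤ (1 + ε)/√2`
(`tsum_gaussianFunction_mul_le`). [cite: Regev2009, Lemma 3.15] -/
theorem toOuterMeasure_discreteGaussian_mem_submodule_le {ε r : ℝ} (hε : 0 < ε) (hr : 0 < r)
    (hηr : Real.sqrt 2 * smoothingParameter L ε ≤ r) {H : Submodule ℝ V} (hH : H ≠ ⊤) :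
    ((discreteGaussian L r 0).toOuterMeasure {x : L | (x : V) ∈ H}).toReal ≤ (1 + ε) / Real.sqrt 2 := by
  borelize V
  -- a unit vector orthogonal to `H`
  have hHo : Hᗮ ≠ ⊥ := by rwa [Ne, Submodule.orthogonal_eq_bot_iff]
  obtain ⟨v, hvH, hv0⟩ := Submodule.exists_mem_ne_zero_of_ne_bot hHo
  set u : V := ‖v‖⁻¹ • v with hu_def
  have hu : ‖u‖ = 1 := norm_smul_inv_norm hv0
  have huH : ∀ x ∈ H, ⟪u, x⟫_ℝ = 0 := fun x hx => by
    rw [hu_def, real_inner_smul_left, real_inner_comm,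
      Submodule.inner_right_of_mem_orthogonal hx hvH, mul_zero]
  -- `Pr[x ∈ H] ≤ E[ρ_r(⟨u, x⟩)]`
  rw [← PMF.toMeasure_apply_eq_toOuterMeasure, ← measureReal_def]
  have hZ : 0 < ∑' x : L, gaussianFunction r ((x : V) - 0) := tsum_gaussianFunction_sub_pos L hr.ne' 0
  rw [measureReal_discreteGaussian_eq L hr 0, div_le_iff₀ hZ]
  simp_rw [sub_zero]
  have hsumρ : Summable fun x : L => gaussianFunction r (x : V) :=
    (summable_gaussianFunction_sub L hr.ne' (0 : V)).congr fun x => by rw [sub_zero]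
  have hsum2 : Summable fun x : L => gaussianFunction r (x : V) * gaussianFunction r (⟪u, (x : V)⟫_ℝ) :=
    Summable.of_nonneg_of_le (fun _ => mul_nonneg (gaussianFunction_pos _ _).le (gaussianFunction_pos _ _).le)
      (fun x => mul_le_of_le_one_right (gaussianFunction_pos _ _).le (gaussianFunction_le_one _ _)) hsumρ
  calc ∑' x : L, gaussianFunction r (x : V) * Set.indicator {x : L | (x : V) ∈ H} 1 x
      ≤ ∑' x : L, gaussianFunction r (x : V) * gaussianFunction r (⟪u, (x : V)⟫_ℝ) := by
        refine Summable.tsum_le_tsum (fun x => ?_) ?_ hsum2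
        · refine mul_le_mul_of_nonneg_left ?_ (gaussianFunction_pos _ _).le
          by_cases hx : (x : V) ∈ H
          · rw [Set.indicator_of_mem (show x ∈ {x : L | (x : V) ∈ H} from hx), Pi.one_apply, huH _ hx,
              gaussianFunction_zero]
          · rw [Set.indicator_of_notMem (show x ∉ {x : L | (x : V) ∈ H} from hx)]
            exact (gaussianFunction_pos _ _).le
        · exact Summable.of_nonneg_of_le (fun _ => mul_nonneg (gaussianFunction_pos _ _).le
            (Set.indicator_nonneg (fun _ _ => zero_le_one) _))
            (fun x => mul_le_of_le_one_right (gaussianFunction_pos _ _).le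
              (Set.indicator_le_self' (fun _ _ => zero_le_one) x)) hsumρ
    _ ≤ (1 + ε) / Real.sqrt 2 * ∑' x : L, gaussianFunction r (x : V) :=
        tsum_gaussianFunction_mul_le L hu hε hr hηr

/-- **Regev 2009, Lemma 3.15 (as printed).** *Let `L` be an `n`-dimensional lattice and let `r` be
such that `r ≥ √2 η_ε(L)` where `ε ≤ 1/10`. Then for any subspace `H` of dimension at most `n - 1` the
probability that `x ∉ H` where `x` is chosen from `D_{L,r}` is at least `1/10`.* Here `H` ranges over
the proper subspaces `H ≠ V` (equivalently `dim H ≤ n - 1`), `0 < ε` is needed for `η_ε`, and a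
proper subspace forces `V` to be nontrivial (so `r ≥ √2 η_ε(L) > 0`). Indeed
`Pr[x ∈ H] ≤ (1 + ε)/√2 ≤ 1.1/√2 < 0.9`. [cite: Regev2009, Lemma 3.15] -/
theorem lemma_3_15 {ε r : ℝ} (hε : 0 < ε) (hε10 : ε ≤ 1 / 10)
    (hηr : Real.sqrt 2 * smoothingParameter L ε ≤ r) {H : Submodule ℝ V} (hH : H ≠ ⊤) :
    1 / 10 ≤ ((discreteGaussian L r 0).toOuterMeasure {x : L | (x : V) ∉ H}).toReal := by
  -- `V` is nontrivial, so `0 < η_ε(L)` and `0 < r`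
  have hnt : Nontrivial V := by
    by_contra h
    rw [not_nontrivial_iff_subsingleton] at h
    exact hH (Subsingleton.elim _ _)
  have hη : 0 < smoothingParameter L ε := smoothingParameter_pos_holds L hε
  have hr : 0 < r := lt_of_lt_of_le (by positivity) hηr
  have hle := toOuterMeasure_discreteGaussian_mem_submodule_le L hε hr hηr hH
  -- complement
  borelize V
  have hcompl : {x : L | (x : V) ∉ H} = {x : L | (x : V) ∈ H}ᶜ := rfl
  have hm : MeasurableSet {x : L | (x : V) ∈ H} := (Set.to_countable _).measurableSet
  haveI : IsProbabilityMeasure (discreteGaussian L r 0).toMeasure := PMF.toMeasure.isProbabilityMeasure _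
  rw [hcompl, ← PMF.toMeasure_apply_eq_toOuterMeasure, prob_compl_eq_one_sub hm,
    PMF.toMeasure_apply_eq_toOuterMeasure,
    ENNReal.toReal_sub_of_le ?_ ENNReal.one_ne_top, ENNReal.toReal_one]
  swap
  · rw [← PMF.toMeasure_apply_eq_toOuterMeasure]
    exact prob_le_one
  -- `(1 + ε)/√2 ≤ 9/10`
  have hsqrt : (1.4 : ℝ) ≤ Real.sqrt 2 := by
    rw [Real.le_sqrt (by norm_num) (by norm_num)]; norm_num
  have h9 : (1 + ε) / Real.sqrt 2 ≤ 9 / 10 := by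
    rw [div_le_iff₀ (by positivity)]
    nlinarith
  linarith

end Lattice

end Regev2009

end Literature.Algebra.EuclideanLattices

end
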